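import Literature.Analysis.FluidPDE.OseenSchemeComplex
import HarnessLib

/-!
# The complexified Oseen scheme: continuity and holomorphy of the free term and of the inner
# integral of the bilinear term

Analysis/FluidPDE file (one auxiliary definition, everything else proved), layer W3b-1 of the proof
of `Literature.Analysis.FluidPDE.lemarieRieusset2016_local_analyticity` (`NSBoundedMildAnalytic.lean`;
Lemarié-Rieusset 2016, Thm. 9.12, proof pp. 260–263). For the operators of `OseenSchemeComplex.lean`
this file supplies the dominated-convergence and "holomorphy under the integral sign"
(`Complex.differentiableOn_integral_of_dominated`, `HolomorphicParametricIntegral.lean`) arguments: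

* comparison lemmas for the Gaussian majorants: monotonicity in time
  (`heatKernel_le_of_mem_Icc`) and recentring (`heatKernel_sub_le_of_norm_sub_le`), and compact
  neighbourhoods inside the parameter domain (`exists_closedBall_subset_schemeDomain`);
* **the free term is a scheme field**: `freeTermC b` is jointly continuous on
  `schemeDomain × ℝ^ι` (in the form `∫ 𝒢(m, (x-y) - m²g) b(y) dy`, `freeTermC_eq_integral_sub`),
  holomorphic in `(m, g)` for every `x`, and bounded by `e²(25/6)^{d/2} M`:
  `isSchemeField_freeTermC` (Lemarié-Rieusset 2016, p. 262: "`V₀` is holomorphic on `t₀ + Ω_γ` and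
  `‖V₀‖_{L^∞(t₀+Ω_γ)} ≤ C_γ‖u(t₀,.)‖_∞`");
* the integrand `duhamelIntegrandC V W p x θ y` of the bilinear term and its **inner integral**
  `∫ duhamelIntegrandC V W p x θ y dy`: pointwise parabolic majorant, integrability and the bound
  `C K_V K_W /(√(1-θ) Re m)` (`norm_integral_duhamelIntegrandC_le`), joint continuity in
  `(p, x, θ)` on `schemeDomain × ℝ^ι × (0,1)` (`continuousAt_integral_duhamelIntegrandC`), and
  holomorphy in `p` (`differentiableOn_integral_duhamelIntegrandC`) — for fields `V, W` of the class
  `IsSchemeField`.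

The outer `θ`-integral (closure of the class under `duhamelC`) is the next file (W3b-2).

## Mathlib / tree search

Tree: W1–W3a; `Complex.differentiableOn_integral_of_dominated` (W0); `exists_norm_oseenKernelC_shift_le`,
`norm_heatKernelC_shift_le`, `continuousOn_oseenKernelC`, `continuousOn_heatKernelC` (W2);
`integrable_add_norm_sq_rpow_neg`, `integral_add_norm_sq_rpow_neg` (`KochTataruKernel.lean`);
`UnboundedOperators.integrable_heatKernel_holds`. Mathlib: `continuousAt_of_dominated`,
`integral_sub_left_eq_self`, `Real.rpow_le_rpow_of_nonpos`, `norm_fst_le`, `norm_snd_le`,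
`norm_integral_le_of_norm_le`.

## References

* P. G. Lemarié-Rieusset, *The Navier–Stokes Problem in the 21st Century*, CRC Press 2016,
  Thm. 9.12, proof pp. 261–263. [LemarieRieusset2016]
-/

noncomputable section

open MeasureTheory Set Filter Metric Real
open _root_.Topology
open scoped BigOperators ENNReal

namespace Literature.Analysis.FluidPDE

open Literature.Analysis.FunctionSpaces.EuclideanSpace (complexify complexify_apply norm_complexify
  continuous_complexify)
open UnboundedOperators (heatKernel)

variable {ι : Type*} [Fintype ι]

/-! ### Gaussian majorants: monotonicity in time and recentring -/

section HeatKernelCompare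

/-- **Monotonicity of the Gaussian majorant in time**: for `0 < s₁ ≤ s ≤ s₂`,
`G_s(z) ≤ (s₂/s₁)^{d/2} G_{s₂}(z)` (the prefactor decreases, the exponential increases in `s`).
[folklore] -/
theorem heatKernel_le_of_mem_Icc {s₁ s₂ s : ℝ} (hs₁ : 0 < s₁) (hs : s ∈ Icc s₁ s₂)
    (z : EuclideanSpace ℝ ι) :
    heatKernel s z ≤ (s₂ / s₁) ^ ((Fintype.card ι : ℝ) / 2) * heatKernel s₂ z := by
  have hs0 : 0 < s := hs₁.trans_le hs.1
  have hs₂ : 0 < s₂ := hs0.trans_le hs.2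
  set d : ℝ := (Fintype.card ι : ℝ) with hd
  have hd0 : 0 ≤ d := Nat.cast_nonneg _
  unfold UnboundedOperators.heatKernel
  rw [finrank_euclideanSpace]
  have h1 : (4 * π * s) ^ (-d / 2) ≤ (4 * π * s₁) ^ (-d / 2) :=
    Real.rpow_le_rpow_of_nonpos (by positivity) (by nlinarith [hs.1, Real.pi_pos]) (by linarith)
  have h2' : (4 * π * s₂) ^ (-d / 2) = (4 * π * s₁) ^ (-d / 2) * (s₂ / s₁) ^ (-d / 2) := by
    rw [show 4 * π * s₂ = (4 * π * s₁) * (s₂ / s₁) by field_simp]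
    exact Real.mul_rpow (by positivity) (by positivity)
  have h2 : (4 * π * s₁) ^ (-d / 2) = (s₂ / s₁) ^ (d / 2) * (4 * π * s₂) ^ (-d / 2) := by
    have : (s₂ / s₁) ^ (d / 2) * (s₂ / s₁) ^ (-d / 2) = 1 := by
      rw [← Real.rpow_add (by positivity)]; ring_nf; exact Real.rpow_zero _
    rw [h2', show (s₂ / s₁) ^ (d / 2) * ((4 * π * s₁) ^ (-d / 2) * (s₂ / s₁) ^ (-d / 2)) =
      ((s₂ / s₁) ^ (d / 2) * (s₂ / s₁) ^ (-d / 2)) * (4 * π * s₁) ^ (-d / 2) by ring, this, one_mul]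
  have h3 : Real.exp (-‖z‖ ^ 2 / (4 * s)) ≤ Real.exp (-‖z‖ ^ 2 / (4 * s₂)) := by
    refine Real.exp_le_exp.2 ?_
    rw [neg_div, neg_div, neg_le_neg_iff]
    exact div_le_div_of_nonneg_left (sq_nonneg _) (by positivity) (by linarith [hs.2])
  calc (4 * π * s) ^ (-d / 2) * Real.exp (-‖z‖ ^ 2 / (4 * s))
      ≤ (4 * π * s₁) ^ (-d / 2) * Real.exp (-‖z‖ ^ 2 / (4 * s₂)) :=
        mul_le_mul h1 h3 (Real.exp_pos _).le (Real.rpow_nonneg (by positivity) _)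
    _ = _ := by rw [h2]; ring

/-- **Recentring the Gaussian majorant**: if `‖x - x₀‖ ≤ 1` then
`G_s(x - y) ≤ 2^{d/2} e^{1/(4s)} G_{2s}(x₀ - y)` (`‖x₀ - y‖² ≤ 2‖x - y‖² + 2`). [folklore] -/
theorem heatKernel_sub_le_of_norm_sub_le {s : ℝ} (hs : 0 < s) {x x₀ : EuclideanSpace ℝ ι}
    (hx : ‖x - x₀‖ ≤ 1) (y : EuclideanSpace ℝ ι) :
    heatKernel s (x - y) ≤
      (2 : ℝ) ^ ((Fintype.card ι : ℝ) / 2) * Real.exp (1 / (4 * s)) * heatKernel (2 * s) (x₀ - y) := by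
  set d : ℝ := (Fintype.card ι : ℝ) with hd
  unfold UnboundedOperators.heatKernel
  rw [finrank_euclideanSpace]
  have hnorm : ‖x₀ - y‖ ≤ ‖x - y‖ + 1 := by
    calc ‖x₀ - y‖ = ‖(x - y) - (x - x₀)‖ := by congr 1; abel
      _ ≤ ‖x - y‖ + ‖x - x₀‖ := norm_sub_le _ _
      _ ≤ ‖x - y‖ + 1 := by linarith
  have hsq : ‖x₀ - y‖ ^ 2 ≤ 2 * ‖x - y‖ ^ 2 + 2 := by
    have h := mul_self_le_mul_self (norm_nonneg _) hnorm
    nlinarith [h, sq_nonneg (‖x - y‖ - 1), norm_nonneg (x - y)]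
  have h1' : (4 * π * (2 * s)) ^ (-d / 2) = (4 * π * s) ^ (-d / 2) * (2 : ℝ) ^ (-d / 2) := by
    rw [show 4 * π * (2 * s) = (4 * π * s) * 2 by ring]
    exact Real.mul_rpow (by positivity) (by norm_num)
  have h1 : (4 * π * s) ^ (-d / 2) = (2 : ℝ) ^ (d / 2) * (4 * π * (2 * s)) ^ (-d / 2) := by
    have : (2 : ℝ) ^ (d / 2) * (2 : ℝ) ^ (-d / 2) = 1 := by
      rw [← Real.rpow_add (by norm_num)]; ring_nf; exact Real.rpow_zero _
    rw [h1', show (2 : ℝ) ^ (d / 2) * ((4 * π * s) ^ (-d / 2) * (2 : ℝ) ^ (-d / 2)) =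
      ((2 : ℝ) ^ (d / 2) * 2 ^ (-d / 2)) * (4 * π * s) ^ (-d / 2) by ring, this, one_mul]
  have h2 : Real.exp (-‖x - y‖ ^ 2 / (4 * s)) ≤
      Real.exp (1 / (4 * s)) * Real.exp (-‖x₀ - y‖ ^ 2 / (4 * (2 * s))) := by
    rw [← Real.exp_add]
    refine Real.exp_le_exp.2 ?_
    have e : 1 / (4 * s) + -‖x₀ - y‖ ^ 2 / (4 * (2 * s)) = (2 - ‖x₀ - y‖ ^ 2) / (8 * s) := by
      field_simp; ring
    rw [e, div_le_div_iff₀ (by positivity) (by positivity)]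
    nlinarith [mul_le_mul_of_nonneg_left hsq hs.le]
  calc (4 * π * s) ^ (-d / 2) * Real.exp (-‖x - y‖ ^ 2 / (4 * s))
      ≤ ((2 : ℝ) ^ (d / 2) * (4 * π * (2 * s)) ^ (-d / 2)) *
          (Real.exp (1 / (4 * s)) * Real.exp (-‖x₀ - y‖ ^ 2 / (4 * (2 * s)))) := by
        rw [h1]
        exact mul_le_mul_of_nonneg_left h2 (by positivity)
    _ = _ := by ring

/-- The parabolic majorant is antitone in the time parameter: for `0 < τ₁ ≤ τ` and `e ≥ 0`,
`(τ + s)^{-e} ≤ (τ₁ + s)^{-e}` (`s ≥ 0`). [folklore] -/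
theorem add_rpow_neg_le_of_le {τ₁ τ s e : ℝ} (hτ₁ : 0 < τ₁) (h : τ₁ ≤ τ) (hs : 0 ≤ s) (he : 0 ≤ e) :
    (τ + s) ^ (-e) ≤ (τ₁ + s) ^ (-e) :=
  Real.rpow_le_rpow_of_nonpos (by positivity) (by linarith) (by linarith)

end HeatKernelCompare

/-! ### Compact neighbourhoods inside the parameter domain -/

/-- Every point `p₀ = (m₀, g₀)` of the domain has a closed ball inside the domain on which
`Re m ≥ Re m₀ / 2` and `‖m‖ ≤ ‖m₀‖ + 1`. [folklore] -/
theorem exists_closedBall_subset_schemeDomain {ν T₀ : ℝ} {p₀ : ℂ × EuclideanSpace ℂ ι}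
    (hp₀ : p₀ ∈ schemeDomain ν T₀) :
    ∃ δ : ℝ, 0 < δ ∧ closedBall p₀ δ ⊆ schemeDomain ν T₀ ∧
      ∀ p ∈ closedBall p₀ δ, p₀.1.re / 2 ≤ p.1.re ∧ ‖p.1‖ ≤ ‖p₀.1‖ + 1 := by
  obtain ⟨ε, hε, hεD⟩ := Metric.isOpen_iff.1 (isOpen_schemeDomain (ι := ι) ν T₀) p₀ hp₀
  have hre : 0 < p₀.1.re := hp₀.1
  refine ⟨min (ε / 2) (min (p₀.1.re / 2) 1), by positivity, ?_, fun p hp => ?_⟩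
  · exact (closedBall_subset_ball (by
      have : min (ε / 2) (min (p₀.1.re / 2) 1) ≤ ε / 2 := min_le_left _ _
      linarith)).trans hεD
  · rw [mem_closedBall, dist_eq_norm] at hp
    have h1 : ‖p.1 - p₀.1‖ ≤ min (ε / 2) (min (p₀.1.re / 2) 1) := (norm_fst_le (p - p₀)).trans hp
    have h2 : min (ε / 2) (min (p₀.1.re / 2) 1) ≤ p₀.1.re / 2 :=
      (min_le_right _ _).trans (min_le_left _ _)
    have h3 : min (ε / 2) (min (p₀.1.re / 2) 1) ≤ 1 := (min_le_right _ _).trans (min_le_right _ _)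
    have hre' : |(p.1 - p₀.1).re| ≤ ‖p.1 - p₀.1‖ := Complex.abs_re_le_norm _
    rw [Complex.sub_re] at hre'
    refine ⟨by linarith [(abs_le.1 hre').1], ?_⟩
    calc ‖p.1‖ = ‖(p.1 - p₀.1) + p₀.1‖ := by rw [sub_add_cancel]
      _ ≤ ‖p.1 - p₀.1‖ + ‖p₀.1‖ := norm_add_le _ _
      _ ≤ ‖p₀.1‖ + 1 := by linarith

/-! ### The free term is a scheme field -/

section FreeTerm

variable {ν T₀ M : ℝ} {b : EuclideanSpace ℝ ι → EuclideanSpace ℝ ι}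

/-- The Gaussian constant `e² (25/6)^{d/2}` of the sector bounds. [folklore] -/
theorem gaussConst_pos : 0 < Real.exp 2 * (25 / 6 : ℝ) ^ ((Fintype.card ι : ℝ) / 2) := by positivity

/-- **The free term with the space variable in the kernel**:
`freeTermC b (m, g) x = ∫ 𝒢(m, (x - y) - m²g) b(y) dy` (the substitution `y ↦ x - y`). [folklore] -/
theorem freeTermC_eq_integral_sub (b : EuclideanSpace ℝ ι → EuclideanSpace ℝ ι)
    (p : ℂ × EuclideanSpace ℂ ι) (x : EuclideanSpace ℝ ι) :
    freeTermC b p x = ∫ y, heatKernelC p.1 (complexify (x - y) - (p.1 ^ 2) • p.2) • complexify (b y) := by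
  unfold freeTermC
  rw [← integral_sub_left_eq_self _ volume x]
  simp only [sub_sub_cancel]

/-- Pointwise bound of the free-term integrand on the admissible set:
`‖𝒢(m, z - m²g) • cx v‖ ≤ e²(25/6)^{d/2} G_{(25/6)(Re m)²}(z) ‖v‖`. [folklore] -/
theorem norm_freeTermC_integrand_le {p : ℂ × EuclideanSpace ℂ ι} (hp : p ∈ schemeDomain ν T₀)
    (z v : EuclideanSpace ℝ ι) :
    ‖heatKernelC p.1 (complexify z - (p.1 ^ 2) • p.2) • complexify v‖ ≤
      Real.exp 2 * (25 / 6 : ℝ) ^ ((Fintype.card ι : ℝ) / 2) * heatKernel (25 / 6 * p.1.re ^ 2) z * ‖v‖ := by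
  obtain ⟨m, g⟩ := p
  rw [norm_smul, norm_complexify]
  exact mul_le_mul_of_nonneg_right (norm_heatKernelC_shift_le hp.1 hp.2.1.le (norm_sq_smul_le hp) z)
    (norm_nonneg _)

/-- Measurability in `y` of the free-term integrand `𝒢(m, (x-y) - m²g) • cx b(y)` for a
measurable datum (`m ≠ 0`). [folklore] -/
theorem aestronglyMeasurable_freeTermC_integrand_sub (hb : AEStronglyMeasurable b volume)
    {p : ℂ × EuclideanSpace ℂ ι} (hm : p.1 ≠ 0) (x : EuclideanSpace ℝ ι) :
    AEStronglyMeasurable (fun y => heatKernelC p.1 (complexify (x - y) - (p.1 ^ 2) • p.2) •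
      complexify (b y)) volume := by
  have h1 : Continuous fun y : EuclideanSpace ℝ ι =>
      heatKernelC p.1 (complexify (x - y) - (p.1 ^ 2) • p.2) := by
    have hc : Continuous fun y : EuclideanSpace ℝ ι =>
        ((p.1, complexify (x - y) - (p.1 ^ 2) • p.2) : ℂ × EuclideanSpace ℂ ι) := by fun_prop
    exact continuousOn_heatKernelC.comp_continuous hc fun y => hm
  exact h1.aestronglyMeasurable.smul (continuous_complexify.comp_aestronglyMeasurable hb)

/-- Measurability in `y` of the free-term integrand `𝒢(m, y - m²g) • cx b(x - y)` for a
measurable datum (`m ≠ 0`). [folklore] -/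
theorem aestronglyMeasurable_freeTermC_integrand (hb : AEStronglyMeasurable b volume)
    {p : ℂ × EuclideanSpace ℂ ι} (hm : p.1 ≠ 0) (x : EuclideanSpace ℝ ι) :
    AEStronglyMeasurable (fun y => heatKernelC p.1 (complexify y - (p.1 ^ 2) • p.2) •
      complexify (b (x - y))) volume := by
  have h1 : Continuous fun y : EuclideanSpace ℝ ι => heatKernelC p.1 (complexify y - (p.1 ^ 2) • p.2) := by
    have hc : Continuous fun y : EuclideanSpace ℝ ι =>
        ((p.1, complexify y - (p.1 ^ 2) • p.2) : ℂ × EuclideanSpace ℂ ι) := by fun_prop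
    exact continuousOn_heatKernelC.comp_continuous hc fun y => hm
  have h2 : AEStronglyMeasurable (fun y : EuclideanSpace ℝ ι => b (x - y)) volume :=
    hb.comp_quasiMeasurePreserving (Measure.measurePreserving_sub_left volume x).quasiMeasurePreserving
  exact h1.aestronglyMeasurable.smul (continuous_complexify.comp_aestronglyMeasurable h2)

/-- **Holomorphy of the free term in the parameters**: for a measurable datum bounded by `M`,
`p ↦ freeTermC b p x` is complex differentiable on the domain for every `x` (holomorphy under the
integral sign with the Gaussian majorant `G_{(25/6)ρ²} ≤ C G_{(25/6)ρ_max²}` on compact balls;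
Lemarié-Rieusset 2016, p. 262: "`V₀` is holomorphic on `t₀ + Ω_γ`"). [cite: LemarieRieusset2016, Thm. 9.12 (proof, p. 262)] -/
theorem differentiableOn_freeTermC (hb : AEStronglyMeasurable b volume)
    (hbM : ∀ y, ‖b y‖ ≤ M) (x : EuclideanSpace ℝ ι) :
    DifferentiableOn ℂ (fun p => freeTermC b p x) (schemeDomain (ι := ι) ν T₀) := by
  unfold freeTermC
  refine Complex.differentiableOn_integral_of_dominated (fun p hp =>
    aestronglyMeasurable_freeTermC_integrand hb (Complex.ne_zero_of_re_pos hp.1) x) ?_ ?_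
  · refine Eventually.of_forall fun y p hp => ?_
    have hsm : DifferentiableAt ℂ (fun q : ℂ × EuclideanSpace ℂ ι => (q.1 ^ 2) • q.2) p :=
      (differentiableAt_fst.pow 2).fun_smul differentiableAt_snd
    have h : DifferentiableAt ℂ
        (fun q : ℂ × EuclideanSpace ℂ ι => heatKernelC q.1 (complexify y - (q.1 ^ 2) • q.2)) p :=
      differentiableAt_fst.heatKernelC ((differentiableAt_const _).sub hsm) (Complex.ne_zero_of_re_pos hp.1)
    exact (h.smul_const _).differentiableWithinAt
  · intro p₀ hp₀
    obtain ⟨δ, hδ, hδD, hδb⟩ := exists_closedBall_subset_schemeDomain hp₀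
    set ρ₀ : ℝ := p₀.1.re with hρ₀
    have hρ₀pos : 0 < ρ₀ := hp₀.1
    set s₁ : ℝ := 25 / 6 * (ρ₀ / 2) ^ 2 with hs₁
    set s₂ : ℝ := 25 / 6 * (‖p₀.1‖ + 1) ^ 2 with hs₂
    have hs₁pos : 0 < s₁ := by positivity
    set K₀ : ℝ := Real.exp 2 * (25 / 6 : ℝ) ^ ((Fintype.card ι : ℝ) / 2) with hK₀
    set L : ℝ := (s₂ / s₁) ^ ((Fintype.card ι : ℝ) / 2) with hL
    have hρle : ρ₀ / 2 ≤ ‖p₀.1‖ + 1 := by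
      have := Complex.re_le_norm p₀.1; rw [← hρ₀] at this; linarith
    have hρ2 : (0 : ℝ) ≤ ρ₀ / 2 := by positivity
    have hs₁₂ : s₁ ≤ s₂ := by rw [hs₁, hs₂]; gcongr
    refine ⟨δ, hδ, ball_subset_closedBall.trans hδD, fun y => K₀ * (L * heatKernel s₂ y) * M, ?_, ?_⟩
    · exact ((UnboundedOperators.integrable_heatKernel_holds (hs₁pos.trans_le hs₁₂)).const_mul _).const_mul _
        |>.mul_const _
    · refine Eventually.of_forall fun y p hp => ?_
      have hpD : p ∈ schemeDomain ν T₀ := hδD (ball_subset_closedBall hp)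
      obtain ⟨hre, hnm⟩ := hδb p (ball_subset_closedBall hp)
      have hre0 : 0 ≤ p.1.re := hρ2.trans hre
      have hre1 : p.1.re ≤ ‖p₀.1‖ + 1 := (Complex.re_le_norm _).trans hnm
      have hs : 25 / 6 * p.1.re ^ 2 ∈ Icc s₁ s₂ := by
        constructor
        · rw [hs₁]; gcongr
        · rw [hs₂]; gcongr
      have hk2 : 0 ≤ heatKernel s₂ y :=
        (UnboundedOperators.heatKernel_pos (hs₁pos.trans_le (hs.1.trans hs.2)) y).le
      calc ‖heatKernelC p.1 (complexify y - (p.1 ^ 2) • p.2) • complexify (b (x - y))‖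
          ≤ K₀ * heatKernel (25 / 6 * p.1.re ^ 2) y * ‖b (x - y)‖ := norm_freeTermC_integrand_le hpD y _
        _ ≤ K₀ * (L * heatKernel s₂ y) * M :=
            mul_le_mul (mul_le_mul_of_nonneg_left (heatKernel_le_of_mem_Icc hs₁pos hs y) (by positivity))
              (hbM _) (norm_nonneg _) (mul_nonneg (by positivity) (mul_nonneg (by positivity) hk2))

/-- **Joint continuity of the free term** on `schemeDomain × ℝ^ι` for a measurable bounded datum
(dominated convergence in the form `∫ 𝒢(m, (x-y) - m²g) b(y) dy`, with the recentred Gaussian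
majorant near `(p₀, x₀)`). [folklore] -/
theorem continuousAt_freeTermC (hb : AEStronglyMeasurable b volume)
    (hbM : ∀ y, ‖b y‖ ≤ M) {p₀ : ℂ × EuclideanSpace ℂ ι} (hp₀ : p₀ ∈ schemeDomain (ι := ι) ν T₀)
    (x₀ : EuclideanSpace ℝ ι) :
    ContinuousAt (fun q : (ℂ × EuclideanSpace ℂ ι) × EuclideanSpace ℝ ι => freeTermC b q.1 q.2)
      (p₀, x₀) := by
  simp only [freeTermC_eq_integral_sub]
  obtain ⟨δ, hδ, hδD, hδb⟩ := exists_closedBall_subset_schemeDomain hp₀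
  set ρ₀ : ℝ := p₀.1.re with hρ₀
  have hρ₀pos : 0 < ρ₀ := hp₀.1
  set s₁ : ℝ := 25 / 6 * (ρ₀ / 2) ^ 2 with hs₁
  set s₂ : ℝ := 25 / 6 * (‖p₀.1‖ + 1) ^ 2 with hs₂
  have hs₁pos : 0 < s₁ := by positivity
  have hs₁₂ : s₁ ≤ s₂ := by
    rw [hs₁, hs₂]; gcongr
    calc ρ₀ / 2 ≤ ρ₀ := by linarith
      _ ≤ ‖p₀.1‖ := Complex.re_le_norm _
      _ ≤ ‖p₀.1‖ + 1 := by linarith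
  have hs₂pos : 0 < s₂ := hs₁pos.trans_le hs₁₂
  set K₀ : ℝ := Real.exp 2 * (25 / 6 : ℝ) ^ ((Fintype.card ι : ℝ) / 2) with hK₀
  set L : ℝ := (s₂ / s₁) ^ ((Fintype.card ι : ℝ) / 2) with hL
  set L' : ℝ := (2 : ℝ) ^ ((Fintype.card ι : ℝ) / 2) * Real.exp (1 / (4 * s₂)) with hL'
  -- the neighbourhood: `p ∈ closedBall p₀ δ`, `‖x - x₀‖ < 1`
  have hnhds : ∀ᶠ q : (ℂ × EuclideanSpace ℂ ι) × EuclideanSpace ℝ ι in 𝓝 (p₀, x₀),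
      q.1 ∈ closedBall p₀ δ ∧ ‖q.2 - x₀‖ < 1 := by
    have h1 : ∀ᶠ q : (ℂ × EuclideanSpace ℂ ι) × EuclideanSpace ℝ ι in 𝓝 (p₀, x₀),
        q.1 ∈ closedBall p₀ δ :=
      (continuous_fst.tendsto _).eventually (closedBall_mem_nhds p₀ hδ)
    have h2 : ∀ᶠ q : (ℂ × EuclideanSpace ℂ ι) × EuclideanSpace ℝ ι in 𝓝 (p₀, x₀),
        ‖q.2 - x₀‖ < 1 := by
      have := (continuous_snd.tendsto ((p₀, x₀) : (ℂ × EuclideanSpace ℂ ι) × EuclideanSpace ℝ ι)).eventually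
        (ball_mem_nhds x₀ one_pos)
      filter_upwards [this] with q hq
      simpa [dist_eq_norm] using hq
    exact h1.and h2
  refine continuousAt_of_dominated ?_ ?_ ?_ ?_ (bound := fun y => K₀ * (L * (L' * heatKernel (2 * s₂) (x₀ - y))) * M)
  · filter_upwards [hnhds] with q hq
    exact aestronglyMeasurable_freeTermC_integrand_sub hb (Complex.ne_zero_of_re_pos (hδD hq.1).1) q.2
  · filter_upwards [hnhds] with q hq
    refine Eventually.of_forall fun y => ?_
    have hpD : q.1 ∈ schemeDomain ν T₀ := hδD hq.1
    obtain ⟨hre, hnm⟩ := hδb q.1 hq.1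
    have hρ2 : (0 : ℝ) ≤ ρ₀ / 2 := by positivity
    have hre0 : 0 ≤ q.1.1.re := hρ2.trans hre
    have hre1 : q.1.1.re ≤ ‖p₀.1‖ + 1 := (Complex.re_le_norm _).trans hnm
    have hs : 25 / 6 * q.1.1.re ^ 2 ∈ Icc s₁ s₂ := by
      constructor
      · rw [hs₁]; gcongr
      · rw [hs₂]; gcongr
    have hk2 : 0 ≤ heatKernel (2 * s₂) (x₀ - y) :=
      (UnboundedOperators.heatKernel_pos (by positivity) _).le
    have hcmp : heatKernel (25 / 6 * q.1.1.re ^ 2) (q.2 - y) ≤ L * (L' * heatKernel (2 * s₂) (x₀ - y)) :=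
      (heatKernel_le_of_mem_Icc hs₁pos hs _).trans (mul_le_mul_of_nonneg_left
        (heatKernel_sub_le_of_norm_sub_le hs₂pos hq.2.le y) (by positivity))
    calc ‖heatKernelC q.1.1 (complexify (q.2 - y) - (q.1.1 ^ 2) • q.1.2) • complexify (b y)‖
        ≤ K₀ * heatKernel (25 / 6 * q.1.1.re ^ 2) (q.2 - y) * ‖b y‖ :=
          norm_freeTermC_integrand_le hpD (q.2 - y) _
      _ ≤ K₀ * (L * (L' * heatKernel (2 * s₂) (x₀ - y))) * M :=
          mul_le_mul (mul_le_mul_of_nonneg_left hcmp (by positivity)) (hbM _) (norm_nonneg _)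
            (mul_nonneg (by positivity) (mul_nonneg (by positivity) (mul_nonneg (by positivity) hk2)))
  · have h := (UnboundedOperators.integrable_heatKernel_holds (E := EuclideanSpace ℝ ι)
      (by positivity : (0 : ℝ) < 2 * s₂)).comp_sub_left x₀
    exact (((h.const_mul _).const_mul _).const_mul _).mul_const _
  · refine Eventually.of_forall fun y => ?_
    have hm0 : p₀.1 ≠ 0 := Complex.ne_zero_of_re_pos hp₀.1
    have hc : Continuous fun q : (ℂ × EuclideanSpace ℂ ι) × EuclideanSpace ℝ ι =>
        ((q.1.1, complexify (q.2 - y) - (q.1.1 ^ 2) • q.1.2) : ℂ × EuclideanSpace ℂ ι) := by fun_prop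
    have h1 : ContinuousAt (fun q : (ℂ × EuclideanSpace ℂ ι) × EuclideanSpace ℝ ι =>
        heatKernelC q.1.1 (complexify (q.2 - y) - (q.1.1 ^ 2) • q.1.2)) (p₀, x₀) := by
      refine ContinuousAt.comp (g := fun r : ℂ × EuclideanSpace ℂ ι => heatKernelC r.1 r.2) ?_
        hc.continuousAt
      exact continuousOn_heatKernelC.continuousAt ((isOpen_ne_fun continuous_fst continuous_const).mem_nhds hm0)
    exact h1.smul continuousAt_const

/-- **The free term is a scheme field**: for `ν, T₀ > 0` and a measurable datum `b` with
`‖b‖ ≤ M` pointwise, `freeTermC b` is jointly continuous on `schemeDomain × ℝ^ι`, holomorphic in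
the parameters, and bounded by `e²(25/6)^{d/2} M` (Lemarié-Rieusset 2016, proof of Thm. 9.12,
p. 262: "`V₀` is holomorphic on `t₀ + Ω_γ` and `‖V₀‖_{L^∞(t₀+Ω_γ)} ≤ C_γ‖u(t₀,.)‖_∞`"). [cite: LemarieRieusset2016, Thm. 9.12 (proof, p. 262)] -/
theorem isSchemeField_freeTermC (hb : AEStronglyMeasurable b volume) (hM : 0 ≤ M)
    (hbM : ∀ y, ‖b y‖ ≤ M) :
    IsSchemeField ν T₀ (Real.exp 2 * (25 / 6 : ℝ) ^ ((Fintype.card ι : ℝ) / 2) * M) (freeTermC b) := by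
  refine ⟨fun q hq => ?_, fun p hp x => norm_freeTermC_le hM hbM hp x,
    differentiableOn_freeTermC hb hbM⟩
  obtain ⟨hp, -⟩ := mem_prod.1 hq
  have h := continuousAt_freeTermC hb hbM (ν := ν) (T₀ := T₀) hp q.2
  exact h.continuousWithinAt

end FreeTerm

/-! ### The integrand of the bilinear term and its inner integral -/

/-- **The integrand of the complexified bilinear term** at `(θ, y) ∈ (0,1) × ℝ^ι`:
`𝒦(√(1-θ) m, y - (1-θ)m²g)[V(√θ m, g)(x - y), W(√θ m, g)(x - y)]`, so that
`duhamelC ν V W p x = ν⁻¹ ∫₀¹ m² ∫ duhamelIntegrandC V W p x θ y dy dθ` (`duhamelC_eq`). [cite: LemarieRieusset2016, Thm. 9.12 (proof, p. 261)] -/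
def duhamelIntegrandC (V W : ℂ × EuclideanSpace ℂ ι → EuclideanSpace ℝ ι → EuclideanSpace ℂ ι)
    (p : ℂ × EuclideanSpace ℂ ι) (x : EuclideanSpace ℝ ι) (θ : ℝ) (y : EuclideanSpace ℝ ι) :
    EuclideanSpace ℂ ι :=
  oseenKernelC ((Real.sqrt (1 - θ) : ℂ) * p.1) (complexify y - (((1 - θ : ℝ) : ℂ) * p.1 ^ 2) • p.2)
    (V ((Real.sqrt θ : ℂ) * p.1, p.2) (x - y)) (W ((Real.sqrt θ : ℂ) * p.1, p.2) (x - y))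

/-- Unfolding the bilinear term through its integrand. [folklore] -/
theorem duhamelC_eq (ν : ℝ) (V W : ℂ × EuclideanSpace ℂ ι → EuclideanSpace ℝ ι → EuclideanSpace ℂ ι)
    (p : ℂ × EuclideanSpace ℂ ι) (x : EuclideanSpace ℝ ι) :
    duhamelC ν V W p x =
      ((ν : ℂ))⁻¹ • ∫ θ in Ioo (0 : ℝ) 1, (p.1 ^ 2) • ∫ y, duhamelIntegrandC V W p x θ y := rfl

section Inner

variable {ν T₀ KV KW : ℝ}
  {V W : ℂ × EuclideanSpace ℂ ι → EuclideanSpace ℝ ι → EuclideanSpace ℂ ι}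

/-- **Parabolic majorant of the integrand**: with `C` the constant of
`exists_norm_oseenKernelC_shift_le`, for fields bounded by `K_V, K_W` on the domain,
`p ∈ schemeDomain`, `θ ∈ (0,1)`:
`‖duhamelIntegrandC V W p x θ y‖ ≤ C ((25/6)(1-θ)(Re m)² + ‖y‖²)^{-(d+1)/2} K_V K_W`. [folklore] -/
theorem norm_duhamelIntegrandC_le {C : ℝ}
    (hC : ∀ {m : ℂ}, 0 < m.re → |m.im| ≤ m.re / 2 → ∀ {c : EuclideanSpace ℂ ι}, ‖c‖ ≤ ‖m‖ →
      ∀ (z : EuclideanSpace ℝ ι) (a b : EuclideanSpace ℂ ι),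
        ‖oseenKernelC m (complexify z - c) a b‖ ≤
          C * (25 / 6 * m.re ^ 2 + ‖z‖ ^ 2) ^ (-(((Module.finrank ℝ (EuclideanSpace ℝ ι) : ℝ) + 1) / 2)) *
            ‖a‖ * ‖b‖)
    (hC0 : 0 ≤ C) (hKV : 0 ≤ KV)
    (hVb : ∀ p ∈ schemeDomain ν T₀, ∀ y, ‖V p y‖ ≤ KV) (hWb : ∀ p ∈ schemeDomain ν T₀, ∀ y, ‖W p y‖ ≤ KW)
    {p : ℂ × EuclideanSpace ℂ ι} (hp : p ∈ schemeDomain ν T₀) (x : EuclideanSpace ℝ ι) {θ : ℝ}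
    (hθ : θ ∈ Ioo (0 : ℝ) 1) (y : EuclideanSpace ℝ ι) :
    ‖duhamelIntegrandC V W p x θ y‖ ≤
      C * (25 / 6 * ((1 - θ) * p.1.re ^ 2) + ‖y‖ ^ 2) ^
          (-(((Module.finrank ℝ (EuclideanSpace ℝ ι) : ℝ) + 1) / 2)) * KV * KW := by
  obtain ⟨m, g⟩ := p
  obtain ⟨hre', him'⟩ := sector_sqrt_one_sub_mul hp hθ.2
  have hc' := norm_kernelShift_le hp hθ.1.le hθ.2
  have hp' := sqrt_mul_mem_schemeDomain hp hθ.1 hθ.2.le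
  have hre_eq : (((Real.sqrt (1 - θ) : ℝ) : ℂ) * m).re ^ 2 = (1 - θ) * m.re ^ 2 := by
    rw [Complex.re_ofReal_mul, mul_pow, Real.sq_sqrt (by linarith [hθ.2])]
  unfold duhamelIntegrandC
  have h := hC hre' him' hc' y (V ((Real.sqrt θ : ℂ) * m, g) (x - y)) (W ((Real.sqrt θ : ℂ) * m, g) (x - y))
  rw [hre_eq] at h
  refine h.trans ?_
  have hw : 0 ≤ C * (25 / 6 * ((1 - θ) * m.re ^ 2) + ‖y‖ ^ 2) ^
      (-(((Module.finrank ℝ (EuclideanSpace ℝ ι) : ℝ) + 1) / 2)) :=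
    mul_nonneg hC0 (Real.rpow_nonneg (by nlinarith [hθ.2, sq_nonneg m.re, sq_nonneg ‖y‖]) _)
  exact mul_le_mul (mul_le_mul_of_nonneg_left (hVb _ hp' _) hw) (hWb _ hp' _) (norm_nonneg _)
    (mul_nonneg hw hKV)

/-- **Continuity of the integrand in all variables**: for jointly continuous fields, the map
`(p, x, θ, y) ↦ duhamelIntegrandC V W p x θ y` is continuous at every point with
`p ∈ schemeDomain`, `θ ∈ (0, 1)`. [folklore] -/
theorem continuousAt_duhamelIntegrandC
    (hVc : ContinuousOn (Function.uncurry V) (schemeDomain ν T₀ ×ˢ univ))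
    (hWc : ContinuousOn (Function.uncurry W) (schemeDomain ν T₀ ×ˢ univ))
    {p₀ : ℂ × EuclideanSpace ℂ ι} (hp₀ : p₀ ∈ schemeDomain (ι := ι) ν T₀) (x₀ : EuclideanSpace ℝ ι)
    {θ₀ : ℝ} (hθ₀ : θ₀ ∈ Ioo (0 : ℝ) 1) (y₀ : EuclideanSpace ℝ ι) :
    ContinuousAt (fun q : (ℂ × EuclideanSpace ℂ ι) × EuclideanSpace ℝ ι × ℝ × EuclideanSpace ℝ ι =>
      duhamelIntegrandC V W q.1 q.2.1 q.2.2.1 q.2.2.2) (p₀, x₀, θ₀, y₀) := by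
  have hD := isOpen_schemeDomain (ι := ι) ν T₀
  -- the field parameter `(√θ m, g)` and the evaluation of `V`, `W`
  have hpar : Continuous fun q : (ℂ × EuclideanSpace ℂ ι) × EuclideanSpace ℝ ι × ℝ × EuclideanSpace ℝ ι =>
      ((((Real.sqrt q.2.2.1 : ℂ) * q.1.1, q.1.2), q.2.1 - q.2.2.2) :
        (ℂ × EuclideanSpace ℂ ι) × EuclideanSpace ℝ ι) := by fun_prop
  have hmem : ((((Real.sqrt θ₀ : ℂ) * p₀.1, p₀.2), x₀ - y₀) : (ℂ × EuclideanSpace ℂ ι) × EuclideanSpace ℝ ι) ∈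
      schemeDomain ν T₀ ×ˢ (univ : Set (EuclideanSpace ℝ ι)) :=
    mk_mem_prod (by simpa using sqrt_mul_mem_schemeDomain (m := p₀.1) (g := p₀.2) hp₀ hθ₀.1 hθ₀.2.le)
      (mem_univ _)
  have hVnhds : ContinuousAt (Function.uncurry V)
      ((((Real.sqrt θ₀ : ℂ) * p₀.1, p₀.2), x₀ - y₀) : (ℂ × EuclideanSpace ℂ ι) × EuclideanSpace ℝ ι) :=
    hVc.continuousAt ((hD.prod isOpen_univ).mem_nhds hmem)
  have hWnhds : ContinuousAt (Function.uncurry W)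
      ((((Real.sqrt θ₀ : ℂ) * p₀.1, p₀.2), x₀ - y₀) : (ℂ × EuclideanSpace ℂ ι) × EuclideanSpace ℝ ι) :=
    hWc.continuousAt ((hD.prod isOpen_univ).mem_nhds hmem)
  have hVat : ContinuousAt (fun q : (ℂ × EuclideanSpace ℂ ι) × EuclideanSpace ℝ ι × ℝ × EuclideanSpace ℝ ι =>
      V ((Real.sqrt q.2.2.1 : ℂ) * q.1.1, q.1.2) (q.2.1 - q.2.2.2)) (p₀, x₀, θ₀, y₀) :=
    ContinuousAt.comp' (g := Function.uncurry V)
      (f := fun q : (ℂ × EuclideanSpace ℂ ι) × EuclideanSpace ℝ ι × ℝ × EuclideanSpace ℝ ι =>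
        ((((Real.sqrt q.2.2.1 : ℂ) * q.1.1, q.1.2), q.2.1 - q.2.2.2) :
          (ℂ × EuclideanSpace ℂ ι) × EuclideanSpace ℝ ι))
      (x := (p₀, x₀, θ₀, y₀)) hVnhds hpar.continuousAt
  have hWat : ContinuousAt (fun q : (ℂ × EuclideanSpace ℂ ι) × EuclideanSpace ℝ ι × ℝ × EuclideanSpace ℝ ι =>
      W ((Real.sqrt q.2.2.1 : ℂ) * q.1.1, q.1.2) (q.2.1 - q.2.2.2)) (p₀, x₀, θ₀, y₀) :=
    ContinuousAt.comp' (g := Function.uncurry W)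
      (f := fun q : (ℂ × EuclideanSpace ℂ ι) × EuclideanSpace ℝ ι × ℝ × EuclideanSpace ℝ ι =>
        ((((Real.sqrt q.2.2.1 : ℂ) * q.1.1, q.1.2), q.2.1 - q.2.2.2) :
          (ℂ × EuclideanSpace ℂ ι) × EuclideanSpace ℝ ι))
      (x := (p₀, x₀, θ₀, y₀)) hWnhds hpar.continuousAt
  -- the kernel arguments
  have hmζ : ContinuousAt (fun q : (ℂ × EuclideanSpace ℂ ι) × EuclideanSpace ℝ ι × ℝ × EuclideanSpace ℝ ι =>
      (((Real.sqrt (1 - q.2.2.1) : ℂ) * q.1.1,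
        complexify q.2.2.2 - (((1 - q.2.2.1 : ℝ) : ℂ) * q.1.1 ^ 2) • q.1.2) :
          ℂ × EuclideanSpace ℂ ι)) (p₀, x₀, θ₀, y₀) :=
    Continuous.continuousAt (by fun_prop)
  have hker : ContinuousAt (fun q : (ℂ × EuclideanSpace ℂ ι) × EuclideanSpace ℝ ι × ℝ × EuclideanSpace ℝ ι =>
      (((Real.sqrt (1 - q.2.2.1) : ℂ) * q.1.1,
        (complexify q.2.2.2 - (((1 - q.2.2.1 : ℝ) : ℂ) * q.1.1 ^ 2) • q.1.2,
        (V ((Real.sqrt q.2.2.1 : ℂ) * q.1.1, q.1.2) (q.2.1 - q.2.2.2),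
        W ((Real.sqrt q.2.2.1 : ℂ) * q.1.1, q.1.2) (q.2.1 - q.2.2.2)))))) (p₀, x₀, θ₀, y₀) :=
    (continuousAt_fst.comp hmζ).prodMk ((continuousAt_snd.comp hmζ).prodMk (hVat.prodMk hWat))
  have hm0 : ((Real.sqrt (1 - θ₀) : ℂ) * p₀.1) ≠ 0 :=
    mul_ne_zero (Complex.ofReal_ne_zero.2 (Real.sqrt_pos.2 (by linarith [hθ₀.2])).ne')
      (Complex.ne_zero_of_re_pos hp₀.1)
  have hKat : ContinuousAt (fun r : ℂ × EuclideanSpace ℂ ι × EuclideanSpace ℂ ι × EuclideanSpace ℂ ι =>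
      oseenKernelC r.1 r.2.1 r.2.2.1 r.2.2.2)
      (((Real.sqrt (1 - θ₀) : ℂ) * p₀.1,
        (complexify y₀ - (((1 - θ₀ : ℝ) : ℂ) * p₀.1 ^ 2) • p₀.2,
        (V ((Real.sqrt θ₀ : ℂ) * p₀.1, p₀.2) (x₀ - y₀),
        W ((Real.sqrt θ₀ : ℂ) * p₀.1, p₀.2) (x₀ - y₀))))) :=
    continuousOn_oseenKernelC.continuousAt ((isOpen_ne_fun continuous_fst continuous_const).mem_nhds hm0)
  unfold duhamelIntegrandC
  exact ContinuousAt.comp'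
    (g := fun r : ℂ × EuclideanSpace ℂ ι × EuclideanSpace ℂ ι × EuclideanSpace ℂ ι =>
      oseenKernelC r.1 r.2.1 r.2.2.1 r.2.2.2)
    (f := fun q : (ℂ × EuclideanSpace ℂ ι) × EuclideanSpace ℝ ι × ℝ × EuclideanSpace ℝ ι =>
      (((Real.sqrt (1 - q.2.2.1) : ℂ) * q.1.1,
        (complexify q.2.2.2 - (((1 - q.2.2.1 : ℝ) : ℂ) * q.1.1 ^ 2) • q.1.2,
        (V ((Real.sqrt q.2.2.1 : ℂ) * q.1.1, q.1.2) (q.2.1 - q.2.2.2),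
        W ((Real.sqrt q.2.2.1 : ℂ) * q.1.1, q.1.2) (q.2.1 - q.2.2.2))))))
    (x := (p₀, x₀, θ₀, y₀)) hKat hker

/-- Measurability in `y` of the integrand (it is continuous in `y`), for `p ∈ schemeDomain`,
`θ ∈ (0,1)`. [folklore] -/
theorem aestronglyMeasurable_duhamelIntegrandC
    (hVc : ContinuousOn (Function.uncurry V) (schemeDomain ν T₀ ×ˢ univ))
    (hWc : ContinuousOn (Function.uncurry W) (schemeDomain ν T₀ ×ˢ univ))
    {p : ℂ × EuclideanSpace ℂ ι} (hp : p ∈ schemeDomain (ι := ι) ν T₀) (x : EuclideanSpace ℝ ι)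
    {θ : ℝ} (hθ : θ ∈ Ioo (0 : ℝ) 1) :
    AEStronglyMeasurable (fun y => duhamelIntegrandC V W p x θ y) volume := by
  have h : Continuous fun y => duhamelIntegrandC V W p x θ y := by
    refine continuous_iff_continuousAt.2 fun y => ?_
    have hc : Continuous fun y : EuclideanSpace ℝ ι =>
        ((p, x, θ, y) : (ℂ × EuclideanSpace ℂ ι) × EuclideanSpace ℝ ι × ℝ × EuclideanSpace ℝ ι) :=
      continuous_const.prodMk (continuous_const.prodMk (continuous_const.prodMk continuous_id))
    exact ContinuousAt.comp' (g := fun q : (ℂ × EuclideanSpace ℂ ι) × EuclideanSpace ℝ ι × ℝ ×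
        EuclideanSpace ℝ ι => duhamelIntegrandC V W q.1 q.2.1 q.2.2.1 q.2.2.2)
      (f := fun y : EuclideanSpace ℝ ι =>
        ((p, x, θ, y) : (ℂ × EuclideanSpace ℂ ι) × EuclideanSpace ℝ ι × ℝ × EuclideanSpace ℝ ι))
      (x := y) (continuousAt_duhamelIntegrandC hVc hWc hp x hθ y) hc.continuousAt
  exact h.aestronglyMeasurable

/-- **Holomorphy of the integrand in the parameters**: for fields holomorphic in `p`,
`p ↦ duhamelIntegrandC V W p x θ y` is complex differentiable on the domain (`θ ∈ (0,1)`). [folklore] -/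
theorem differentiableOn_duhamelIntegrandC
    (hVd : ∀ x, DifferentiableOn ℂ (fun p => V p x) (schemeDomain (ι := ι) ν T₀))
    (hWd : ∀ x, DifferentiableOn ℂ (fun p => W p x) (schemeDomain (ι := ι) ν T₀))
    (x : EuclideanSpace ℝ ι) {θ : ℝ} (hθ : θ ∈ Ioo (0 : ℝ) 1) (y : EuclideanSpace ℝ ι) :
    DifferentiableOn ℂ (fun p => duhamelIntegrandC V W p x θ y) (schemeDomain (ι := ι) ν T₀) := by
  intro p hp
  have hD := isOpen_schemeDomain (ι := ι) ν T₀
  have hp' : ((((Real.sqrt θ : ℂ) * p.1, p.2)) : ℂ × EuclideanSpace ℂ ι) ∈ schemeDomain ν T₀ := by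
    have := sqrt_mul_mem_schemeDomain (m := p.1) (g := p.2) hp hθ.1 hθ.2.le
    simpa using this
  have hpar : DifferentiableAt ℂ (fun q : ℂ × EuclideanSpace ℂ ι =>
      ((((Real.sqrt θ : ℂ) * q.1, q.2)) : ℂ × EuclideanSpace ℂ ι)) p :=
    (differentiableAt_fst.const_mul _).prodMk differentiableAt_snd
  have hVat : DifferentiableAt ℂ (fun q : ℂ × EuclideanSpace ℂ ι =>
      V ((Real.sqrt θ : ℂ) * q.1, q.2) (x - y)) p :=
    DifferentiableAt.fun_comp' (x := p) (g := fun r : ℂ × EuclideanSpace ℂ ι => V r (x - y))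
      (f := fun q : ℂ × EuclideanSpace ℂ ι => ((((Real.sqrt θ : ℂ) * q.1, q.2)) : ℂ × EuclideanSpace ℂ ι))
      ((hVd (x - y)).differentiableAt (hD.mem_nhds hp')) hpar
  have hWat : DifferentiableAt ℂ (fun q : ℂ × EuclideanSpace ℂ ι =>
      W ((Real.sqrt θ : ℂ) * q.1, q.2) (x - y)) p :=
    DifferentiableAt.fun_comp' (x := p) (g := fun r : ℂ × EuclideanSpace ℂ ι => W r (x - y))
      (f := fun q : ℂ × EuclideanSpace ℂ ι => ((((Real.sqrt θ : ℂ) * q.1, q.2)) : ℂ × EuclideanSpace ℂ ι))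
      ((hWd (x - y)).differentiableAt (hD.mem_nhds hp')) hpar
  have hm0 : ((Real.sqrt (1 - θ) : ℂ) * p.1) ≠ 0 :=
    mul_ne_zero (Complex.ofReal_ne_zero.2 (Real.sqrt_pos.2 (by linarith [hθ.2])).ne')
      (Complex.ne_zero_of_re_pos hp.1)
  have hsm : DifferentiableAt ℂ (fun q : ℂ × EuclideanSpace ℂ ι =>
      ((((1 - θ : ℝ)) : ℂ) * q.1 ^ 2) • q.2) p :=
    ((differentiableAt_fst.pow 2).const_mul _).fun_smul differentiableAt_snd
  unfold duhamelIntegrandC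
  refine DifferentiableAt.differentiableWithinAt ?_
  exact (differentiableAt_fst.const_mul _).oseenKernelC ((differentiableAt_const _).sub hsm)
    hVat hWat hm0

/-- **Integrability and size of the inner integral**: with `C` the constant of
`exists_norm_oseenKernelC_shift_le` and `M₀ = ∫ (1+‖w‖²)^{-(d+1)/2} dw`, for fields of the class,
`p ∈ schemeDomain`, `θ ∈ (0,1)`: `y ↦ duhamelIntegrandC V W p x θ y` is integrable and
`‖∫ duhamelIntegrandC V W p x θ y dy‖ ≤ C M₀ (25/6)^{-1/2} K_V K_W / (√(1-θ) Re m)`. [folklore] -/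
theorem norm_integral_duhamelIntegrandC_le {C : ℝ}
    (hC : ∀ {m : ℂ}, 0 < m.re → |m.im| ≤ m.re / 2 → ∀ {c : EuclideanSpace ℂ ι}, ‖c‖ ≤ ‖m‖ →
      ∀ (z : EuclideanSpace ℝ ι) (a b : EuclideanSpace ℂ ι),
        ‖oseenKernelC m (complexify z - c) a b‖ ≤
          C * (25 / 6 * m.re ^ 2 + ‖z‖ ^ 2) ^ (-(((Module.finrank ℝ (EuclideanSpace ℝ ι) : ℝ) + 1) / 2)) *
            ‖a‖ * ‖b‖)
    (hC0 : 0 ≤ C) (hKV : 0 ≤ KV) (_hKW : 0 ≤ KW)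
    (hVc : ContinuousOn (Function.uncurry V) (schemeDomain ν T₀ ×ˢ univ))
    (hWc : ContinuousOn (Function.uncurry W) (schemeDomain ν T₀ ×ˢ univ))
    (hVb : ∀ p ∈ schemeDomain ν T₀, ∀ y, ‖V p y‖ ≤ KV) (hWb : ∀ p ∈ schemeDomain ν T₀, ∀ y, ‖W p y‖ ≤ KW)
    {p : ℂ × EuclideanSpace ℂ ι} (hp : p ∈ schemeDomain (ι := ι) ν T₀) (x : EuclideanSpace ℝ ι)
    {θ : ℝ} (hθ : θ ∈ Ioo (0 : ℝ) 1) :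
    Integrable (fun y => duhamelIntegrandC V W p x θ y) volume ∧
      ‖∫ y, duhamelIntegrandC V W p x θ y‖ ≤
        C * (∫ w : EuclideanSpace ℝ ι, (1 + ‖w‖ ^ 2) ^
          (-(((Module.finrank ℝ (EuclideanSpace ℝ ι) : ℝ) + 1) / 2))) *
          (25 / 6 : ℝ) ^ (-(1 / 2 : ℝ)) * KV * KW / (Real.sqrt (1 - θ) * p.1.re) := by
  set d : ℝ := (Module.finrank ℝ (EuclideanSpace ℝ ι) : ℝ) with hd
  set e : ℝ := (d + 1) / 2 with he
  have hde : d < 2 * e := by rw [he]; linarith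
  set M₀ : ℝ := ∫ w : EuclideanSpace ℝ ι, (1 + ‖w‖ ^ 2) ^ (-e) with hM₀
  have hM₀0 : 0 < M₀ := integral_one_add_norm_sq_rpow_neg_pos hde
  have hre : 0 < p.1.re := hp.1
  set τ : ℝ := 25 / 6 * ((1 - θ) * p.1.re ^ 2) with hτ
  have h1θ : 0 < 1 - θ := by linarith [hθ.2]
  have hτ0 : 0 < τ := by positivity
  set bound : EuclideanSpace ℝ ι → ℝ := fun y => C * KV * KW * (τ + ‖y‖ ^ 2) ^ (-e) with hbound
  have hbi : Integrable bound := (integrable_add_norm_sq_rpow_neg hde hτ0).const_mul _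
  have hdom : ∀ y, ‖duhamelIntegrandC V W p x θ y‖ ≤ bound y := by
    intro y
    have h := norm_duhamelIntegrandC_le hC hC0 hKV hVb hWb hp x hθ y
    calc _ ≤ _ := h
      _ = bound y := by simp only [hbound, hτ, he]; ring
  have hint : Integrable (fun y => duhamelIntegrandC V W p x θ y) volume :=
    hbi.mono' (aestronglyMeasurable_duhamelIntegrandC hVc hWc hp x hθ) (Eventually.of_forall hdom)
  refine ⟨hint, (norm_integral_le_of_norm_le hbi (Eventually.of_forall hdom)).trans (le_of_eq ?_)⟩
  rw [hbound, integral_const_mul, integral_add_norm_sq_rpow_neg hτ0, ← hd]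
  have hscal : d / 2 - e = -(1 / 2 : ℝ) := by rw [he]; ring
  rw [hscal, hτ]
  have hs : 0 < Real.sqrt (1 - θ) := Real.sqrt_pos.2 h1θ
  have hτpow : (25 / 6 * ((1 - θ) * p.1.re ^ 2)) ^ (-(1 / 2 : ℝ)) =
      (25 / 6 : ℝ) ^ (-(1 / 2 : ℝ)) * (Real.sqrt (1 - θ) * p.1.re)⁻¹ := by
    rw [Real.mul_rpow (by norm_num) (by positivity)]
    congr 1
    rw [Real.rpow_neg (by positivity), ← Real.sqrt_eq_rpow, Real.sqrt_mul h1θ.le,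
      Real.sqrt_sq hre.le]
  rw [hτpow, ← hM₀]
  field_simp

/-- **Holomorphy of the inner integral in the parameters** (holomorphy under the integral sign,
`Complex.differentiableOn_integral_of_dominated`, with the parabolic majorant at the smallest time
of a compact ball): for fields of the class and `θ ∈ (0,1)`,
`p ↦ ∫ duhamelIntegrandC V W p x θ y dy` is complex differentiable on `schemeDomain`. [folklore] -/
theorem differentiableOn_integral_duhamelIntegrandC (hKV : 0 ≤ KV) (hKW : 0 ≤ KW)
    (hV : IsSchemeField ν T₀ KV V) (hW : IsSchemeField ν T₀ KW W)
    (x : EuclideanSpace ℝ ι) {θ : ℝ} (hθ : θ ∈ Ioo (0 : ℝ) 1) :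
    DifferentiableOn ℂ (fun p => ∫ y, duhamelIntegrandC V W p x θ y) (schemeDomain (ι := ι) ν T₀) := by
  obtain ⟨C, hC, hK⟩ := exists_norm_oseenKernelC_shift_le (ι := ι)
  set d : ℝ := (Module.finrank ℝ (EuclideanSpace ℝ ι) : ℝ) with hd
  set e : ℝ := (d + 1) / 2 with he
  have hde : d < 2 * e := by rw [he]; linarith
  have he0 : 0 ≤ e := by rw [he, hd]; positivity
  have h1θ : 0 < 1 - θ := by linarith [hθ.2]
  refine Complex.differentiableOn_integral_of_dominated
    (fun p hp => aestronglyMeasurable_duhamelIntegrandC hV.continuousOn hW.continuousOn hp x hθ)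
    (Eventually.of_forall fun y => differentiableOn_duhamelIntegrandC hV.differentiableOn
      hW.differentiableOn x hθ y) ?_
  intro p₀ hp₀
  obtain ⟨δ, hδ, hδD, hδb⟩ := exists_closedBall_subset_schemeDomain hp₀
  set ρ₀ : ℝ := p₀.1.re with hρ₀
  have hρ₀pos : 0 < ρ₀ := hp₀.1
  set τ₁ : ℝ := 25 / 6 * ((1 - θ) * (ρ₀ / 2) ^ 2) with hτ₁
  have hτ₁pos : 0 < τ₁ := by positivity
  refine ⟨δ, hδ, ball_subset_closedBall.trans hδD, fun y => C * KV * KW * (τ₁ + ‖y‖ ^ 2) ^ (-e),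
    (integrable_add_norm_sq_rpow_neg hde hτ₁pos).const_mul _, ?_⟩
  refine Eventually.of_forall fun y p hp => ?_
  have hpD : p ∈ schemeDomain ν T₀ := hδD (ball_subset_closedBall hp)
  obtain ⟨hre, -⟩ := hδb p (ball_subset_closedBall hp)
  have h := norm_duhamelIntegrandC_le hK hC.le hKV hV.norm_le hW.norm_le hpD x hθ y
  have hρ2 : (0 : ℝ) ≤ ρ₀ / 2 := by positivity
  have hτle : τ₁ ≤ 25 / 6 * ((1 - θ) * p.1.re ^ 2) := by
    rw [hτ₁]; gcongr
  have hw : (25 / 6 * ((1 - θ) * p.1.re ^ 2) + ‖y‖ ^ 2) ^ (-e) ≤ (τ₁ + ‖y‖ ^ 2) ^ (-e) :=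
    add_rpow_neg_le_of_le hτ₁pos hτle (sq_nonneg _) he0
  calc _ ≤ _ := h
    _ ≤ C * (τ₁ + ‖y‖ ^ 2) ^ (-e) * KV * KW :=
        mul_le_mul_of_nonneg_right (mul_le_mul_of_nonneg_right
          (mul_le_mul_of_nonneg_left hw hC.le) hKV) hKW
    _ = C * KV * KW * (τ₁ + ‖y‖ ^ 2) ^ (-e) := by ring

/-- **Joint continuity of the inner integral in `(p, x, θ)`** at every point with
`p ∈ schemeDomain`, `θ ∈ (0,1)` (dominated convergence: the integrand is continuous in all
variables and bears the parabolic majorant at the smallest time of a neighbourhood,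
`θ ≤ (θ₀+1)/2`, `Re m ≥ Re m₀/2`). [folklore] -/
theorem continuousAt_integral_duhamelIntegrandC (hKV : 0 ≤ KV) (hKW : 0 ≤ KW)
    (hV : IsSchemeField ν T₀ KV V) (hW : IsSchemeField ν T₀ KW W)
    {p₀ : ℂ × EuclideanSpace ℂ ι} (hp₀ : p₀ ∈ schemeDomain (ι := ι) ν T₀) (x₀ : EuclideanSpace ℝ ι)
    {θ₀ : ℝ} (hθ₀ : θ₀ ∈ Ioo (0 : ℝ) 1) :
    ContinuousAt (fun q : (ℂ × EuclideanSpace ℂ ι) × EuclideanSpace ℝ ι × ℝ =>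
      ∫ y, duhamelIntegrandC V W q.1 q.2.1 q.2.2 y) (p₀, x₀, θ₀) := by
  obtain ⟨C, hC, hK⟩ := exists_norm_oseenKernelC_shift_le (ι := ι)
  set d : ℝ := (Module.finrank ℝ (EuclideanSpace ℝ ι) : ℝ) with hd
  set e : ℝ := (d + 1) / 2 with he
  have hde : d < 2 * e := by rw [he]; linarith
  have he0 : 0 ≤ e := by rw [he, hd]; positivity
  obtain ⟨δ, hδ, hδD, hδb⟩ := exists_closedBall_subset_schemeDomain hp₀
  set ρ₀ : ℝ := p₀.1.re with hρ₀
  have hρ₀pos : 0 < ρ₀ := hp₀.1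
  set θ₂ : ℝ := (θ₀ + 1) / 2 with hθ₂
  have hθ₂lt : θ₂ < 1 := by rw [hθ₂]; linarith [hθ₀.2]
  have hθ₀₂ : θ₀ < θ₂ := by rw [hθ₂]; linarith [hθ₀.2]
  set τ₁ : ℝ := 25 / 6 * ((1 - θ₂) * (ρ₀ / 2) ^ 2) with hτ₁
  have hτ₁pos : 0 < τ₁ := by
    have : 0 < 1 - θ₂ := by linarith
    positivity
  -- the neighbourhood
  have hnhds : ∀ᶠ q : (ℂ × EuclideanSpace ℂ ι) × EuclideanSpace ℝ ι × ℝ in 𝓝 (p₀, x₀, θ₀),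
      q.1 ∈ closedBall p₀ δ ∧ q.2.2 ∈ Ioo (θ₀ / 2) θ₂ := by
    have h1 : ∀ᶠ q : (ℂ × EuclideanSpace ℂ ι) × EuclideanSpace ℝ ι × ℝ in 𝓝 (p₀, x₀, θ₀),
        q.1 ∈ closedBall p₀ δ :=
      (continuous_fst.tendsto _).eventually (closedBall_mem_nhds p₀ hδ)
    have h2 : ∀ᶠ q : (ℂ × EuclideanSpace ℂ ι) × EuclideanSpace ℝ ι × ℝ in 𝓝 (p₀, x₀, θ₀),
        q.2.2 ∈ Ioo (θ₀ / 2) θ₂ := by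
      have hc : Continuous fun q : (ℂ × EuclideanSpace ℂ ι) × EuclideanSpace ℝ ι × ℝ => q.2.2 := by
        fun_prop
      exact hc.continuousAt.preimage_mem_nhds
        (Ioo_mem_nhds (show θ₀ / 2 < θ₀ by linarith [hθ₀.1]) (show θ₀ < θ₂ from hθ₀₂))
    exact h1.and h2
  have hθsub : ∀ {θ : ℝ}, θ ∈ Ioo (θ₀ / 2) θ₂ → θ ∈ Ioo (0 : ℝ) 1 := fun {θ} hθ =>
    ⟨by linarith [hθ.1, hθ₀.1], hθ.2.trans hθ₂lt⟩
  refine continuousAt_of_dominated ?_ ?_ ?_ ?_ (bound := fun y => C * KV * KW * (τ₁ + ‖y‖ ^ 2) ^ (-e))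
  · filter_upwards [hnhds] with q hq
    exact aestronglyMeasurable_duhamelIntegrandC hV.continuousOn hW.continuousOn (hδD hq.1) q.2.1 (hθsub hq.2)
  · filter_upwards [hnhds] with q hq
    refine Eventually.of_forall fun y => ?_
    have hpD : q.1 ∈ schemeDomain ν T₀ := hδD hq.1
    obtain ⟨hre, -⟩ := hδb q.1 hq.1
    have h := norm_duhamelIntegrandC_le hK hC.le hKV hV.norm_le hW.norm_le hpD q.2.1 (hθsub hq.2) y
    have hθle : q.2.2 ≤ θ₂ := hq.2.2.le
    have hρ2 : (0 : ℝ) ≤ ρ₀ / 2 := by positivity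
    have h1θ₂ : 0 ≤ 1 - θ₂ := by linarith
    have h1q : 0 ≤ 1 - q.2.2 := by linarith
    have hτle : τ₁ ≤ 25 / 6 * ((1 - q.2.2) * q.1.1.re ^ 2) := by
      rw [hτ₁]; gcongr
    have hw : (25 / 6 * ((1 - q.2.2) * q.1.1.re ^ 2) + ‖y‖ ^ 2) ^ (-e) ≤ (τ₁ + ‖y‖ ^ 2) ^ (-e) :=
      add_rpow_neg_le_of_le hτ₁pos hτle (sq_nonneg _) he0
    calc _ ≤ _ := h
      _ ≤ C * (τ₁ + ‖y‖ ^ 2) ^ (-e) * KV * KW :=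
          mul_le_mul_of_nonneg_right (mul_le_mul_of_nonneg_right
            (mul_le_mul_of_nonneg_left hw hC.le) hKV) hKW
      _ = C * KV * KW * (τ₁ + ‖y‖ ^ 2) ^ (-e) := by ring
  · exact (integrable_add_norm_sq_rpow_neg hde hτ₁pos).const_mul _
  · refine Eventually.of_forall fun y => ?_
    have hc : Continuous fun q : (ℂ × EuclideanSpace ℂ ι) × EuclideanSpace ℝ ι × ℝ =>
        ((q.1, q.2.1, q.2.2, y) : (ℂ × EuclideanSpace ℂ ι) × EuclideanSpace ℝ ι × ℝ × EuclideanSpace ℝ ι) :=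
      continuous_fst.prodMk ((continuous_fst.comp continuous_snd).prodMk
        ((continuous_snd.comp continuous_snd).prodMk continuous_const))
    exact ContinuousAt.comp' (g := fun r : (ℂ × EuclideanSpace ℂ ι) × EuclideanSpace ℝ ι × ℝ ×
        EuclideanSpace ℝ ι => duhamelIntegrandC V W r.1 r.2.1 r.2.2.1 r.2.2.2)
      (f := fun q : (ℂ × EuclideanSpace ℂ ι) × EuclideanSpace ℝ ι × ℝ =>
        ((q.1, q.2.1, q.2.2, y) : (ℂ × EuclideanSpace ℂ ι) × EuclideanSpace ℝ ι × ℝ × EuclideanSpace ℝ ι))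
      (x := (p₀, x₀, θ₀))
      (continuousAt_duhamelIntegrandC hV.continuousOn hW.continuousOn hp₀ x₀ hθ₀ y) hc.continuousAt

end Inner

end Literature.Analysis.FluidPDE

end
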